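import Summits.FinalStateConjecture.FinalStateConjecture.Theorems.PhotonSphereChannelsEndVisibleTransport
import Literature.Geometry.Lorentzian.CauchyDevelopmentIsometryClasses
import Literature.Geometry.Lorentzian.LeviCivitaProofs
import HarnessLib

/-!
# Route BondiDrainDispersal · crux `HorizonlessMustDrain` (stmt-FinalStateConjecture-9976), line `birth`,
# stub W2b `stub_noHorizon_transport`: the ray-theoretic no-horizon clause is invariant under isometry of
# developments

Helper file of the line `birth` of `Theses.BondiDrainDispersal.HorizonlessMustDrain`
(`--supports stmt-FinalStateConjecture-9976`).  The crux's no-event-horizon hypothesis on a development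
`𝒟` reads: it is FALSE that some event `q` lies outside the chronological past `I⁻(γ(dom ∩ [0, ∞)))` of
every future-complete normalised null ray `γ` issued from the data hypersurface.  For Cauchy
developments `𝒟₁`, `𝒟₂` of one datum which are isometric as developments
(`CauchyDevelopment.IsIsometricTo`: a time-orientation preserving isometric diffeomorphism
`ψ : M₁ ≃ M₂` with `ψ ∘ ι₁ = ι₂`) this clause passes from `𝒟₁` to `𝒟₂`
(`stub_noHorizon_transport`, the registered stub, last declaration).  Contrapositively we transport a
HIDDEN event the other way (`StubNoHorizonTransport.hidden_transport`): if `q₂` is hidden in `𝒟₂`, then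
`ψ⁻¹ q₂` is hidden in `𝒟₁`, because `ψ` carries complete normalised null rays from `ι₁ p` to complete
normalised null rays from `ι₂ p` with the same affine domain
(`EndVisible.isNormalisedNullRayFrom_comp`, with the inverse package `EndVisible.symm_package`) and
chronological pasts into chronological pasts (`EndVisible.mem_chronologicalPast_comp`).  Everything is
proved; no named fact is introduced or consumed.
References: Choquet-Bruhat–Geroch, Comm. Math. Phys. 14 (1969) 329–335; O'Neill, *Semi-Riemannian
geometry* (1983), Ch. 3, pp. 58, 90–91, Ch. 14, p. 402; Sbierski, Ann. Henri Poincaré 17 (2016), §2.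
-/

set_option linter.dupNamespace false

noncomputable section

open scoped Manifold ContDiff Topology
open Set Function

namespace Summit.FinalStateConjecture.FinalStateConjecture.Theorems.BondiDrainDispersalHorizonlessMustDrain

open Literature.Geometry.Lorentzian

namespace StubNoHorizonTransport

variable {X : Type} [TopologicalSpace X] [ChartedSpace E3 X] [IsManifold (𝓡 3) ∞ X]
  [ConnectedSpace X] {D : InitialDataSet (𝓡 3) X} {𝒟₁ 𝒟₂ : CauchyDevelopment D}

/-- **Hidden events pull back along isometries of developments.** If `𝒟₁` is isometric to `𝒟₂` as a
development (`ψ : M₁ ≃ M₂`) and some event `q₂` of `𝒟₂` lies outside `I⁻(γ(dom ∩ [0, ∞)))` for every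
future-complete normalised null ray `γ` of `𝒟₂` from the data, then `ψ⁻¹ q₂` lies outside
`I⁻(γ(dom ∩ [0, ∞)))` for every future-complete normalised null ray `γ` of `𝒟₁` from the data: `ψ ∘ γ` is
a complete normalised null ray of `𝒟₂` from the same `p` on the same `dom`
(`EndVisible.isNormalisedNullRayFrom_comp`), and `ψ⁻¹ q₂ ∈ I⁻(γ(A))` would give
`q₂ = ψ (ψ⁻¹ q₂) ∈ I⁻((ψ ∘ γ)(A))` (`EndVisible.mem_chronologicalPast_comp`).  The Levi-Civita instances
quantified in the clause exist outright (`PseudoRiemannianMetric.hasLeviCivita`) and are propositions.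
[cite: ONeillSemiRiemannian1983, Ch. 3, pp. 90–91] -/
theorem hidden_transport (h : 𝒟₁.IsIsometricTo 𝒟₂)
    (h₂ : ∀ [𝒟₂.metric.HasLeviCivita], ∃ q : 𝒟₂.carrier, ∀ (p : X) (γ : ℝ → 𝒟₂.carrier) (dom : Set ℝ),
      𝒟₂.metric.IsNormalisedNullRayFrom 𝒟₂.timeOrientation 𝒟₂.embed 𝒟₂.normal p γ dom →
        ¬ BddAbove dom → q ∉ 𝒟₂.metric.chronologicalPast 𝒟₂.timeOrientation (γ '' (dom ∩ Ici 0))) :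
    ∀ [𝒟₁.metric.HasLeviCivita], ∃ q : 𝒟₁.carrier, ∀ (p : X) (γ : ℝ → 𝒟₁.carrier) (dom : Set ℝ),
      𝒟₁.metric.IsNormalisedNullRayFrom 𝒟₁.timeOrientation 𝒟₁.embed 𝒟₁.normal p γ dom →
        ¬ BddAbove dom → q ∉ 𝒟₁.metric.chronologicalPast 𝒟₁.timeOrientation (γ '' (dom ∩ Ici 0)) := by
  intro inst₁
  haveI : 𝒟₂.metric.HasLeviCivita := PseudoRiemannianMetric.hasLeviCivita _
  obtain ⟨q₂, hq₂⟩ := h₂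
  obtain ⟨ψ, hiso, hτ, hι⟩ := h
  obtain ⟨hφ', -, -⟩ := EndVisible.symm_package ψ hiso hτ hι
  have hφ : 𝒟₁.metric.IsIsometricImmersion 𝒟₂.metric.toPseudoRiemannianMetric ψ := ⟨ψ.contMDiff, hiso⟩
  refine ⟨ψ.symm q₂, fun p γ dom hγ hdom hq ↦ ?_⟩
  -- push the ray forward to `𝒟₂`
  have hγ₂ : 𝒟₂.metric.IsNormalisedNullRayFrom 𝒟₂.timeOrientation 𝒟₂.embed 𝒟₂.normal p (ψ ∘ γ) dom :=
    EndVisible.isNormalisedNullRayFrom_comp hφ hφ' ψ.symm_apply_apply hτ hι hγ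
  -- push the chronological relation forward to `𝒟₂`
  have hq' := EndVisible.mem_chronologicalPast_comp hφ hτ hq
  rw [ψ.apply_symm_apply, ← image_comp] at hq'
  exact hq₂ p (ψ ∘ γ) dom hγ₂ hdom hq'

end StubNoHorizonTransport

open StubNoHorizonTransport

/-- **W2b — THE NO-HORIZON CLAUSE IS INVARIANT UNDER ISOMETRY OF DEVELOPMENTS.** If `𝒟₁`, `𝒟₂` are
Cauchy developments of the same datum, isometric as developments (`ψ : M₁ ≃ M₂` isometric,
time-orientation preserving, `ψ ∘ ι₁ = ι₂`, `CauchyDevelopment.IsIsometricTo`), and `𝒟₁` has no event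
horizon in the ray-theoretic sense of the crux (it is false that some event is outside
`I⁻(γ(dom ∩ [0, ∞)))` for every future-complete normalised null ray `γ` from the data), neither has `𝒟₂`:
a hidden event `q₂` of `𝒟₂` would pull back to the hidden event `ψ⁻¹ q₂` of `𝒟₁`
(`StubNoHorizonTransport.hidden_transport`: `ψ` maps complete normalised null rays from `ι₁ p` to
complete normalised null rays from `ι₂ p` with the same affine domain and chronological pasts into
chronological pasts).  O'Neill 1983, Ch. 3, pp. 90–91; Choquet-Bruhat–Geroch 1969.
[cite: ONeillSemiRiemannian1983, Ch. 3, pp. 90–91] -/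
theorem stub_noHorizon_transport : open scoped Manifold in
    ∀ {X : Type} [TopologicalSpace X] [ChartedSpace Literature.Geometry.Lorentzian.E3 X]
      [IsManifold (𝓡 3) ((⊤ : ℕ∞) : WithTop ℕ∞) X] [ConnectedSpace X]
      {D : Literature.Geometry.Lorentzian.InitialDataSet (𝓡 3) X}
      (𝒟₁ 𝒟₂ : Literature.Geometry.Lorentzian.CauchyDevelopment D),
      𝒟₁.IsIsometricTo 𝒟₂ →
      ¬ (∀ [𝒟₁.metric.HasLeviCivita], ∃ q : 𝒟₁.carrier, ∀ (p : X) (γ : ℝ → 𝒟₁.carrier) (dom : Set ℝ),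
          𝒟₁.metric.IsNormalisedNullRayFrom 𝒟₁.timeOrientation 𝒟₁.embed 𝒟₁.normal p γ dom → ¬ BddAbove dom →
            q ∉ 𝒟₁.metric.chronologicalPast 𝒟₁.timeOrientation (γ '' (dom ∩ Set.Ici 0))) →
      ¬ (∀ [𝒟₂.metric.HasLeviCivita], ∃ q : 𝒟₂.carrier, ∀ (p : X) (γ : ℝ → 𝒟₂.carrier) (dom : Set ℝ),
          𝒟₂.metric.IsNormalisedNullRayFrom 𝒟₂.timeOrientation 𝒟₂.embed 𝒟₂.normal p γ dom → ¬ BddAbove dom →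
            q ∉ 𝒟₂.metric.chronologicalPast 𝒟₂.timeOrientation (γ '' (dom ∩ Set.Ici 0))) := by
  intro X _ _ _ _ D 𝒟₁ 𝒟₂ h h₁ h₂
  exact h₁ (hidden_transport h h₂)

end Summit.FinalStateConjecture.FinalStateConjecture.Theorems.BondiDrainDispersalHorizonlessMustDrain

end
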